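import Mathlib
import Literature.NumberTheory.LFunctions.Zhang2022.Section15BEq1515ResidueSide
import Literature.NumberTheory.LFunctions.Zhang2022.Section15BEq1515PhiBounds
import Literature.NumberTheory.LFunctions.Zhang2022.Section15BEq1515OpenBox
import Literature.NumberTheory.LFunctions.Zhang2022.GaussKernelContourScales
import Literature.NumberTheory.LFunctions.Zhang2022.Section15Eq1514
import Literature.NumberTheory.LFunctions.Zhang2022.Section15BCalM1Identity
import Literature.NumberTheory.LFunctions.Zhang2022.Section15BCoprimeLocalEstimate
import HarnessLib

/-!
# Zhang (2022) §15 (15.15), RANGED + WEIGHTED reading of record — the assembly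
# `Eq1515.eq15_15_ranged` (theorems only)

Topic `Literature/NumberTheory/LFunctions/Zhang2022` (Landau–Siegel audit tree; verdict-neutral).
Y. Zhang, *Discrete mean estimates and the Landau–Siegel zero*, arXiv:2211.02515v1 (2022)
[Zhang2022LandauSiegel] — **an unrefereed manuscript under adjudication; nothing here asserts or denies
its Theorems 1–2.** Display (15.15), §15 p. 85 (tex L4218–4224): "Assume `dl < PT⁻²` … In a way similar
to the proof of Lemma 8.4, we deduce that `𝒟₁(d,l) = λ₁(d)Σ_{j≤3}ℛ_{1j}d^{β_j}ℳ₁(d,l;1−β_j) + O(ε₁)`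
… (15.16) also has a simple pole at `s = ρ̃ − 1`, while the residue at this point can be regarded as an
acceptable error." Lane ZHANG-L, WP15, leaf `h15_17 : Typed.Section15B.Eq15_17 c′ bChi`; the (15.15)W
STATEMENT OF RECORD (zl-w15-p1, `INTERFACE-1515`; cell rows G-L4t2-1 / G-d24-1 pattern): RANGED
(`dl < P·t₀·T⁻³`, which is where `P₄/d > T` — the support of `b` reaches only there,
`Skeleton.bcoef_eq_zero_of_P4_div_bigT_le`) and WEIGHTED (error `E(D)·W(d,l)`,
`W(d,l) = ∏_{q∣dl}(1 + c₀q^{−9/10})`, `E(D) = C·(e^{−c𝓛^{1/10}} + 𝓛⁻¹⁹⁹⁴)` — the `ρ̃`-residue is only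
polynomially small). It is the `h15W` input of `Typed.Section15B.eq15_17_chi_of` (p482514), with the decay
side condition supplied by `Typed.Section15B.eq15_15_error_decay_pow` (p483421).

THE ASSEMBLY (every analytic input is a landed theorem; this file is bookkeeping):
* §15.u036 (`Typed.Section15B.step15_u036_of_eq15_14` ∘ `eq15_14_holds` ∘ `step15_u034_of` ∘
  `step15_u030_holds`): `𝒟₁(d,l) = λ₁(d)·(1/2π)∫_ℝ G(1+it)dt + O(e^{−c𝓛¹⁰})`, `G = integrandU036`;
* `G = Φ·K` on `Re s = 1` with the regularised `Φ(s) = ζ(1+s+β₁)ζ(1+s+β₂)ℳ₁(d,l;1+s)d^{β₃}s/(ζ₁(1+s)L(1+s,χ))`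
  and the Gaussian Perron kernel `K(s) = (P₄/d)^{s+β₃}ω₁(s+β₃)/(s+β₃)` (`integrandU036_line_eq`);
* the contour core `Eq1515.core` (zl-w15-p1, p480151) on Landau's rectangle `[−c₁/𝓛, 1] × [−𝓛²⁰, 𝓛²⁰]`,
  its analytic inputs from `Eq1515.phi1515_bounds` / `continuous_phi1515_line` (zl-w09-p1, p478879), the
  open-box non-vanishing from `Eq1515.open_box_of_closed_region` (compactness), and the remainder
  arithmetic `GaussKernelContour.remainder_le_eps1` (zl-libC-p2, p476896): remainder `≤ C·W·e^{−(c₁/2)𝓛^{1/10}}`;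
* the residues: `Eq1515.res_sum_eq_sum_calR1` (the three main residues ARE `ℛ_{1j}d^{β_j}ℳ₁(d,l;1−β_j)`)
  and `Eq1515.norm_resRho_1515_le` (the `ρ̃ − 1` residue `≪ 𝓛²⁸(1−ρ̃)·W ≪ 𝓛⁻¹⁹⁹⁴·W`, with
  `1 − ρ̃ ≤ K𝓛⁻²⁰²²` from `Lemma84.exceptional_package`, whose exceptional zero is identified with the one of
  `phi1515_bounds` by the package's own zero-free clause) (zl-w10-p6 g2, p483821);
* `|λ₁(d)| ≤ ∏_{q∣d}(1 + 8/q)` and the merging of the three weights into one `c₀`.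
Theorems only; no definitions; standard axioms. WHAT THIS IS NOT: a proof of (15.15) AS PRINTED
(`Typed.Section15B.Eq15_15`: all `dl < PT⁻²`, uniform `ε₁`) — that reading is recorded false-as-printed
(G-L4t2-1); nor any claim about Theorems 1–2 or Landau–Siegel zeros.

## References
* Y. Zhang, arXiv:2211.02515v1 (2022), §15 (15.14)–(15.16) pp. 84–85; §8 proof of Lemma 8.4 p. 46.
  [cite: Zhang2022LandauSiegel, §15 (15.15) p. 85]
* H. L. Montgomery, R. C. Vaughan, *Multiplicative Number Theory I* (2007), §6.2, Thm 11.4.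
  [cite: MontgomeryVaughan2007, §6.2]
-/

noncomputable section

open Complex Real Set Filter Topology MeasureTheory
open scoped Interval

namespace Literature.NumberTheory.LFunctions.Zhang2022.Eq1515

open Literature.NumberTheory.LFunctions.Zhang2022.Skeleton
open Literature.NumberTheory.LFunctions.Zhang2022.GaussWeight
open Literature.NumberTheory.LFunctions.Zhang2022.Typed.Section15A
open Literature.NumberTheory.LFunctions.Zhang2022.Typed.Section15B

/-! ### Small helpers -/

/-- `P₄^{s+β}/d^{s} = (P₄/d)^{s+β}·d^{β}` (`d ≥ 1`, `P₄ > 0`). [folklore] -/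
private theorem P4_cpow_div_cpow_eq {D d : ℕ} (hd : 1 ≤ d) (hP : 0 < P4 D) (s β : ℂ) :
    (P4 D : ℂ) ^ (s + β) / (d : ℂ) ^ s = ((P4 D / d : ℝ) : ℂ) ^ (s + β) * (d : ℂ) ^ β := by
  have hd0 : (0 : ℝ) < d := by exact_mod_cast hd
  have hdC : (d : ℂ) ≠ 0 := by exact_mod_cast hd0.ne'
  have h1 : ((P4 D / d : ℝ) : ℂ) = ((P4 D : ℝ) : ℂ) * (((d : ℝ)⁻¹ : ℝ) : ℂ) := by
    push_cast; rw [div_eq_mul_inv]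
  rw [h1, Complex.mul_cpow_ofReal_nonneg hP.le (inv_nonneg.mpr hd0.le)]
  have h2 : (((d : ℝ)⁻¹ : ℝ) : ℂ) = ((d : ℂ))⁻¹ := by push_cast; rfl
  rw [h2, Complex.inv_cpow _ _ (by
    rw [show (d : ℂ) = ((d : ℝ) : ℂ) by simp, Complex.arg_ofReal_of_nonneg hd0.le]
    exact Real.pi_pos.ne), Complex.cpow_add _ _ hdC]
  have h3 : (d : ℂ) ^ β ≠ 0 := by
    rw [Ne, Complex.cpow_eq_zero_iff]; exact fun h => hdC h.1
  have h4 : (d : ℂ) ^ s ≠ 0 := by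
    rw [Ne, Complex.cpow_eq_zero_iff]; exact fun h => hdC h.1
  field_simp

/-- `‖λ₁(d)‖ ≤ ∏_{q∣d}(1 + 8/q)` (`λ₁` is a product over the prime factors, `‖λ₁(q) − 1‖ ≤ 8/q`,
`Typed.Section15B.norm_lam1_prime_one_sub_one_le`). [cite: Zhang2022LandauSiegel, §15 (15.10) p. 82] -/
theorem norm_lam1_one_le_prod (c' : ℝ) {D : ℕ} (χ : DirichletCharacter ℂ D) (d : ℕ) :
    ‖lam1 c' χ d 1‖ ≤ ∏ q ∈ d.primeFactors, (1 + 8 / (q : ℝ)) := by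
  have hprod : lam1 c' χ d 1 = ∏ q ∈ d.primeFactors, lam1 c' χ q 1 := by
    unfold lam1
    refine Finset.prod_congr rfl fun q hq => ?_
    rw [(Nat.prime_of_mem_primeFactors hq).primeFactors, Finset.prod_singleton]
  rw [hprod]
  refine (Finset.norm_prod_le _ _).trans (Finset.prod_le_prod (fun q _ => norm_nonneg _) fun q hq => ?_)
  have hqP := Nat.prime_of_mem_primeFactors hq
  have h := norm_lam1_prime_one_sub_one_le c' χ hqP
  calc ‖lam1 c' χ q 1‖ = ‖(lam1 c' χ q 1 - 1) + 1‖ := by rw [sub_add_cancel]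
    _ ≤ ‖lam1 c' χ q 1 - 1‖ + ‖(1 : ℂ)‖ := norm_add_le _ _
    _ ≤ 8 / (q : ℝ) + 1 := by rw [norm_one]; linarith
    _ = 1 + 8 / (q : ℝ) := by ring

/-- Weights: `∏_{q∈s}(1 + a·q^{−9/10}) ≤ ∏_{q∈s}(1 + b·q^{−9/10})` for `0 ≤ a ≤ b`. [folklore] -/
private theorem weight_mono {s : Finset ℕ} {a b : ℝ} (ha : 0 ≤ a) (hab : a ≤ b) :
    ∏ q ∈ s, (1 + a * (q : ℝ) ^ (-(9 / 10 : ℝ))) ≤ ∏ q ∈ s, (1 + b * (q : ℝ) ^ (-(9 / 10 : ℝ))) := by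
  refine Finset.prod_le_prod (fun q _ => by positivity) fun q _ => ?_
  have : 0 ≤ (q : ℝ) ^ (-(9 / 10 : ℝ)) := Real.rpow_nonneg (Nat.cast_nonneg q) _
  nlinarith

/-- Weights multiply into one weight over the prime factors: for `0 ≤ a, b`,
`∏_{q∣n}(1 + a q^{−9/10})·∏_{q∣n}(1 + b q^{−9/10}) ≤ ∏_{q∣n}(1 + (a+b+ab) q^{−9/10})`
(`q^{−9/5} ≤ q^{−9/10}` for `q ≥ 1`). [folklore] -/
private theorem weight_mul_weight_le {n : ℕ} {a b : ℝ} (ha : 0 ≤ a) (hb : 0 ≤ b) :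
    (∏ q ∈ n.primeFactors, (1 + a * (q : ℝ) ^ (-(9 / 10 : ℝ)))) *
        ∏ q ∈ n.primeFactors, (1 + b * (q : ℝ) ^ (-(9 / 10 : ℝ))) ≤
      ∏ q ∈ n.primeFactors, (1 + (a + b + a * b) * (q : ℝ) ^ (-(9 / 10 : ℝ))) := by
  rw [← Finset.prod_mul_distrib]
  refine Finset.prod_le_prod (fun q _ => by positivity) fun q hq => ?_
  have hq1 : (1 : ℝ) ≤ q := by exact_mod_cast (Nat.prime_of_mem_primeFactors hq).one_lt.le
  set x : ℝ := (q : ℝ) ^ (-(9 / 10 : ℝ)) with hx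
  have hx0 : 0 ≤ x := Real.rpow_nonneg (by linarith) _
  have hx1 : x ≤ 1 := Real.rpow_le_one_of_one_le_of_nonpos hq1 (by norm_num)
  have hxx : x * x ≤ x := by nlinarith
  nlinarith [mul_nonneg ha hb, mul_nonneg (mul_nonneg ha hb) (sub_nonneg.mpr hxx)]

/-- `|∏_{q∈s}(1 + c·x_q)| ≤ ∏_{q∈s}(1 + |c|·x_q)` for `x_q = q^{−9/10} ≥ 0`. [folklore] -/
private theorem abs_weight_le {s : Finset ℕ} (c : ℝ) :
    |∏ q ∈ s, (1 + c * (q : ℝ) ^ (-(9 / 10 : ℝ)))| ≤ ∏ q ∈ s, (1 + |c| * (q : ℝ) ^ (-(9 / 10 : ℝ))) := by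
  rw [Finset.abs_prod]
  refine Finset.prod_le_prod (fun q _ => abs_nonneg _) fun q _ => ?_
  have hx : 0 ≤ (q : ℝ) ^ (-(9 / 10 : ℝ)) := Real.rpow_nonneg (Nat.cast_nonneg q) _
  calc |1 + c * (q : ℝ) ^ (-(9 / 10 : ℝ))| ≤ |(1 : ℝ)| + |c * (q : ℝ) ^ (-(9 / 10 : ℝ))| := abs_add_le _ _
    _ = 1 + |c| * (q : ℝ) ^ (-(9 / 10 : ℝ)) := by rw [abs_one, abs_mul, abs_of_nonneg hx]

/-- `∏_{q∣d}(1 + 8/q) ≤ ∏_{q∣dl}(1 + 8 q^{−9/10})` (`1/q ≤ q^{−9/10}`; extra factors are `≥ 1`).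
[folklore] -/
private theorem prod_one_add_div_le_weight {d l : ℕ} (hd : d ≠ 0) (hl : l ≠ 0) :
    ∏ q ∈ d.primeFactors, (1 + 8 / (q : ℝ)) ≤
      ∏ q ∈ (d * l).primeFactors, (1 + 8 * (q : ℝ) ^ (-(9 / 10 : ℝ))) := by
  have hsub : d.primeFactors ⊆ (d * l).primeFactors := by
    rw [Nat.primeFactors_mul hd hl]; exact Finset.subset_union_left
  calc ∏ q ∈ d.primeFactors, (1 + 8 / (q : ℝ))
      ≤ ∏ q ∈ d.primeFactors, (1 + 8 * (q : ℝ) ^ (-(9 / 10 : ℝ))) := by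
        refine Finset.prod_le_prod (fun q _ => by positivity) fun q hq => ?_
        have hq1 : (1 : ℝ) ≤ q := by exact_mod_cast (Nat.prime_of_mem_primeFactors hq).one_lt.le
        have hq0 : (0 : ℝ) < q := by linarith
        have : 8 / (q : ℝ) ≤ 8 * (q : ℝ) ^ (-(9 / 10 : ℝ)) := by
          rw [div_eq_mul_inv, ← Real.rpow_neg_one]
          exact mul_le_mul_of_nonneg_left
            (Real.rpow_le_rpow_of_exponent_le hq1 (by norm_num)) (by norm_num)
        linarith
    _ ≤ ∏ q ∈ (d * l).primeFactors, (1 + 8 * (q : ℝ) ^ (-(9 / 10 : ℝ))) := by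
        have hf0 : ∀ q : ℕ, 0 ≤ 1 + 8 * (q : ℝ) ^ (-(9 / 10 : ℝ)) := fun q => by
          have : 0 ≤ (q : ℝ) ^ (-(9 / 10 : ℝ)) := Real.rpow_nonneg (Nat.cast_nonneg q) _
          linarith
        have hf1 : ∀ q : ℕ, 1 ≤ 1 + 8 * (q : ℝ) ^ (-(9 / 10 : ℝ)) := fun q => by
          have : 0 ≤ (q : ℝ) ^ (-(9 / 10 : ℝ)) := Real.rpow_nonneg (Nat.cast_nonneg q) _
          linarith
        rw [← Finset.prod_sdiff hsub]
        exact le_mul_of_one_le_left (Finset.prod_nonneg fun q _ => hf0 q)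
          (Finset.one_le_prod fun q _ => hf1 q)

/-- `M ≤ 𝓛 = log D` for all large `D`. [folklore] -/
private theorem exists_nat_le_ell' (M : ℝ) : ∃ D₀ : ℕ, ∀ D : ℕ, D₀ ≤ D → M ≤ ell D := by
  refine ⟨⌈Real.exp M⌉₊ + 1, fun D hD => ?_⟩
  have h1 : Real.exp M ≤ D := by
    have : (⌈Real.exp M⌉₊ : ℝ) + 1 ≤ D := by exact_mod_cast hD
    linarith [Nat.le_ceil (Real.exp M)]
  have hD0 : (0 : ℝ) < D := lt_of_lt_of_le (Real.exp_pos M) h1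
  rw [ell, Real.le_log_iff_exp_le hD0]
  exact h1

/-- `2(ℓ²⁰ + 1) ≤ e^{ℓ}` once `ℓ ≥ 4·21!` (`e^ℓ ≥ ℓ²¹/21!`). [folklore] -/
private theorem two_mul_pow_twenty_le_exp {ℓ : ℝ} (hℓ : 4 * (Nat.factorial 21 : ℝ) ≤ ℓ) :
    2 * (ℓ ^ 20 + 1) ≤ Real.exp ℓ := by
  have hf : (1 : ℝ) ≤ (Nat.factorial 21 : ℝ) := by exact_mod_cast Nat.one_le_iff_ne_zero.mpr (Nat.factorial_ne_zero 21)
  have hf0 : (0 : ℝ) < (Nat.factorial 21 : ℝ) := by linarith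
  have hℓ1 : 1 ≤ ℓ := by linarith
  have hℓ0 : 0 ≤ ℓ := by linarith
  have h1 : ℓ ^ 21 / (Nat.factorial 21 : ℝ) ≤ Real.exp ℓ := Real.pow_div_factorial_le_exp ℓ hℓ0 21
  have h20 : 1 ≤ ℓ ^ 20 := one_le_pow₀ hℓ1
  have h2 : 2 * (ℓ ^ 20 + 1) * (Nat.factorial 21 : ℝ) ≤ ℓ ^ 21 := by
    calc 2 * (ℓ ^ 20 + 1) * (Nat.factorial 21 : ℝ) ≤ (4 * ℓ ^ 20) * (Nat.factorial 21 : ℝ) := by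
          nlinarith
      _ = (4 * (Nat.factorial 21 : ℝ)) * ℓ ^ 20 := by ring
      _ ≤ ℓ * ℓ ^ 20 := mul_le_mul_of_nonneg_right hℓ (by positivity)
      _ = ℓ ^ 21 := by ring
  have h3 : 2 * (ℓ ^ 20 + 1) ≤ ℓ ^ 21 / (Nat.factorial 21 : ℝ) := by
    rw [le_div_iff₀ hf0]; exact h2
  exact h3.trans h1

/-- The §15.u036 integrand on the line `Re s = 1` is `Φ·K` with the regularised
`Φ(s) = ζ(1+s+β₁)ζ(1+s+β₂)ℳ₁(d,l;1+s)d^{β₃}s/(ζ₁(1+s)L(1+s,χ))` and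
`K(s) = (P₄/d)^{s+β₃}ω₁(s+β₃)/(s+β₃)`. [cite: Zhang2022LandauSiegel, §15 p. 85] -/
theorem integrandU036_line_eq (c' : ℝ) {D : ℕ} [NeZero D] (χ : DirichletCharacter ℂ D) {d : ℕ}
    (hd : 1 ≤ d) (hP : 0 < P4 D) (l : ℕ) {Φ : ℂ → ℂ}
    (hΦ : ∀ s, Φ s = riemannZeta (1 + s + beta1 c' D) * riemannZeta (1 + s + beta2 c' D) *
      calM1 c' χ d l (1 + s) * (d : ℂ) ^ beta3 c' D * s /
      (riemannZeta₁ (1 + s) * χ.LFunction (1 + s))) (t : ℝ) :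
    integrandU036 c' χ d l (1 + t * I) =
      Φ (((1 : ℝ) : ℂ) + t * I) * ((((P4 D / d : ℝ) : ℂ)) ^ ((((1 : ℝ) : ℂ) + t * I) + beta3 c' D) *
        omega1 (ell D ^ 30) ((((1 : ℝ) : ℂ) + t * I) + beta3 c' D) /
          ((((1 : ℝ) : ℂ) + t * I) + beta3 c' D)) := by
  have h1 : (((1 : ℝ) : ℂ) + t * I) = 1 + t * I := by push_cast; ring
  have hs0 : (1 + t * I : ℂ) ≠ 0 := by
    intro h; have := congrArg Complex.re h; simp at this
  rw [h1, Phi_eq_of_ne_zero χ Φ (calM1 c' χ d l) ((d : ℂ) ^ beta3 c' D) (beta1 c' D) (beta2 c' D)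
    hΦ hs0]
  unfold integrandU036
  rw [P4_cpow_div_cpow_eq hd hP (1 + t * I) (beta3 c' D)]
  ring

/-! ### The shifts `β₁, β₂, β₃` at a large modulus -/

/-- The shift package at a large modulus (`𝓛 ≥ 3`, `𝓛 ≥ 240|c′| + 1`): `0 < α ≤ 1/4`; `β_j = i·b_j` with
`α/2 ≤ b₁ < b₂ < b₃ ≤ 4α`; hence the `β_j` are purely imaginary, non-zero, pairwise distinct, of norm
`b_j ≤ 1`. [cite: Zhang2022LandauSiegel, §2 (2.13), (2.22)] -/
private theorem shifts_package (c' : ℝ) {D : ℕ} (hℓ3 : 3 ≤ ell D) (hℓc' : 240 * |c'| + 1 ≤ ell D) :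
    0 < alpha D ∧ alpha D ≤ 1 / 4 ∧
    (beta1 c' D).re = 0 ∧ (beta2 c' D).re = 0 ∧ (beta3 c' D).re = 0 ∧
    (beta1 c' D).im = b1 c' D ∧ (beta2 c' D).im = b2 c' D ∧ (beta3 c' D).im = b3 c' D ∧
    alpha D / 2 ≤ b1 c' D ∧ b1 c' D < b2 c' D ∧ b2 c' D < b3 c' D ∧ b3 c' D ≤ 4 * alpha D ∧
    ‖beta1 c' D‖ = b1 c' D ∧ ‖beta2 c' D‖ = b2 c' D ∧ ‖beta3 c' D‖ = b3 c' D := by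
  set ℓ : ℝ := ell D with hℓdef
  have hℓ1 : 1 ≤ ℓ := by linarith
  have hℓ0 : 0 < ℓ := by linarith
  have hα : alpha D = Real.pi / ℓ ^ 9 := by rw [alpha, log_bigP]
  have hα0 : 0 < alpha D := by rw [hα]; positivity
  have hℓ90 : 0 < ℓ ^ 9 := by positivity
  have hπ4 : Real.pi ≤ 4 := Real.pi_lt_four.le
  have hαℓ : alpha D * ℓ ≤ 4 / ℓ := by
    have hℓ29 : ℓ ^ 2 ≤ ℓ ^ 9 := pow_le_pow_right₀ hℓ1 (by norm_num)
    rw [hα, div_mul_eq_mul_div, div_le_div_iff₀ hℓ90 hℓ0]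
    calc Real.pi * ℓ * ℓ = Real.pi * ℓ ^ 2 := by ring
      _ ≤ 4 * ℓ ^ 2 := mul_le_mul_of_nonneg_right hπ4 (by positivity)
      _ ≤ 4 * ℓ ^ 9 := by linarith
  have hα14 : alpha D ≤ 1 / 4 := by
    rw [hα, div_le_iff₀ hℓ90]
    have h39 : (3 : ℝ) ^ 9 ≤ ℓ ^ 9 := pow_le_pow_left₀ (by norm_num) hℓ3 9
    nlinarith
  -- `θ = c′αℓ`, `|θ| ≤ 1/60`
  obtain ⟨θ, hθdef⟩ : ∃ θ : ℝ, θ = c' * alpha D * ℓ := ⟨_, rfl⟩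
  have hθ : |θ| ≤ 1 / 60 := by
    rw [hθdef, abs_mul, abs_mul, abs_of_pos hα0, abs_of_pos hℓ0]
    calc |c'| * alpha D * ℓ = |c'| * (alpha D * ℓ) := by ring
      _ ≤ |c'| * (4 / ℓ) := mul_le_mul_of_nonneg_left hαℓ (abs_nonneg _)
      _ = 4 * |c'| / ℓ := by ring
      _ ≤ 1 / 60 := by rw [div_le_div_iff₀ hℓ0 (by norm_num)]; linarith
  obtain ⟨hθ1, hθ2⟩ := abs_le.mp hθ
  have hβ1 : beta1 c' D = (b1 c' D : ℂ) * I := beta1_eq_b1_mul_I c' D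
  have hβ2 : beta2 c' D = (b2 c' D : ℂ) * I := beta2_eq_b2_mul_I c' D
  have hβ3 : beta3 c' D = (b3 c' D : ℂ) * I := beta3_eq_b3_mul_I c' D
  have hb1 : b1 c' D = alpha D * (1 - 5 * θ) := by rw [hθdef, b1]; ring
  have hb2 : b2 c' D = 2 * alpha D * (1 + θ) := by rw [hθdef, b2]
  have hb3 : b3 c' D = 3 * alpha D * (1 - θ) := by rw [hθdef, b3]
  have hαθ1 : 0 ≤ alpha D * (1 / 2 - 5 * θ) := mul_nonneg hα0.le (by linarith)
  have hαθ4 : 0 ≤ alpha D * (1 / 3 + θ) := mul_nonneg hα0.le (by linarith)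
  have hαθ5 : 0 < alpha D * (1 + 7 * θ) := mul_pos hα0 (by linarith)
  have hαθ6 : 0 < alpha D * (1 - 5 * θ) := mul_pos hα0 (by linarith)
  have hb1lo : alpha D / 2 ≤ b1 c' D := by rw [hb1]; linarith
  have hb3hi : b3 c' D ≤ 4 * alpha D := by rw [hb3]; linarith
  have hb12 : b1 c' D < b2 c' D := by rw [hb1, hb2]; linarith
  have hb23 : b2 c' D < b3 c' D := by rw [hb2, hb3]; linarith
  have hα20 : 0 < alpha D / 2 := half_pos hα0
  have hb1pos : 0 < b1 c' D := hα20.trans_le hb1lo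
  have hb2pos : 0 < b2 c' D := hb1pos.trans hb12
  have hb3pos : 0 < b3 c' D := hb2pos.trans hb23
  have hnorm : ∀ {β : ℂ} {b : ℝ}, β = (b : ℂ) * I → 0 < b → ‖β‖ = b := by
    intro β b h hb
    rw [h, norm_mul, Complex.norm_I, mul_one, Complex.norm_real, Real.norm_eq_abs, abs_of_pos hb]
  refine ⟨hα0, hα14, by rw [hβ1]; simp, by rw [hβ2]; simp, by rw [hβ3]; simp,
    by rw [hβ1]; simp, by rw [hβ2]; simp, by rw [hβ3]; simp, hb1lo, hb12, hb23, hb3hi,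
    hnorm hβ1 hb1pos, hnorm hβ2 hb2pos, hnorm hβ3 hb3pos⟩

/-! ### The exceptional zero: identification and thresholds -/

/-- The exceptional zero package at a large modulus. If `ρ` is the zero exported by the Part-A
package (real, `L(ρ,χ) = 0`, and `L(w,χ) ≠ 0` for `w ≠ ρ` with `Re w ≥ 1 − c₁/𝓛`, `|Im w| ≤ D/2`) and
`ρ'` the zero of `Lemma84.exceptional_package` (`L(ρ',χ) = 0`, `1 − ρ' ≤ K𝓛⁻²⁰²²`), then for
`𝓛 ≥ max(1, K/c₁ + 1, K/δ₀ + 1, 2K/c_L + 2)`: `ρ' = ρ`, `1 − ρ ≤ δ₀` and `1 − c_L/(𝓛 + log 4) ≤ ρ`.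
[cite: Zhang2022LandauSiegel, §5 Lemma 5.5 p. 10] -/
private theorem rho_package {D : ℕ} [NeZero D] (χ : DirichletCharacter ℂ D)
    {c₁ K δ₀ cL ρ ρ' : ℝ}
    (hc₁0 : 0 < c₁) (hK0 : 0 < K) (hδ₀0 : 0 < δ₀) (hcL0 : 0 < cL)
    (hℓ1 : 1 ≤ ell D) (hℓKc₁ : K / c₁ + 1 ≤ ell D) (hℓKδ : K / δ₀ + 1 ≤ ell D)
    (hℓKc : 2 * K / cL + 2 ≤ ell D) (hℓ4 : Real.log 4 ≤ ell D)
    (hLρ' : χ.LFunction ρ' = 0) (hρ'K : 1 - ρ' ≤ K * (Real.log D ^ 2022)⁻¹)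
    (hLreg : ∀ w : ℂ, 1 - c₁ / ell D ≤ w.re → |w.im| ≤ (D : ℝ) / 2 → w ≠ (ρ : ℂ) →
      χ.LFunction w ≠ 0) :
    ρ' = ρ ∧ 1 - ρ ≤ δ₀ ∧ 1 - cL / (Real.log D + Real.log 4) ≤ ρ := by
  have hℓ0 : 0 < ell D := by linarith
  have hlogD : Real.log (D : ℝ) = ell D := rfl
  have hK1 : K * (Real.log D ^ 2022)⁻¹ ≤ K / ell D ^ 2 := by
    rw [← div_eq_mul_inv, hlogD]
    exact div_le_div_of_nonneg_left hK0.le (by positivity) (pow_le_pow_right₀ hℓ1 (by norm_num))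
  have hK2 : K / ell D ^ 2 ≤ K / ell D :=
    div_le_div_of_nonneg_left hK0.le hℓ0 (by nlinarith)
  -- `ρ' = ρ`
  have hKc₁ : K / ell D ^ 2 ≤ c₁ / ell D := by
    rw [div_le_div_iff₀ (by positivity) hℓ0]
    have h3 : K ≤ c₁ * ell D := by
      have := mul_le_mul_of_nonneg_left (by linarith : K / c₁ ≤ ell D) hc₁0.le
      rwa [mul_div_cancel₀ _ hc₁0.ne'] at this
    nlinarith
  have hρρ : ρ' = ρ := by
    by_contra hne0
    have hre : 1 - c₁ / ell D ≤ ((ρ' : ℂ)).re := by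
      simp only [Complex.ofReal_re]; linarith [hK1.trans hKc₁]
    have him : |((ρ' : ℂ)).im| ≤ (D : ℝ) / 2 := by simp; positivity
    have hneC : (ρ' : ℂ) ≠ (ρ : ℂ) := fun h => hne0 (by exact_mod_cast h)
    exact hLreg (ρ' : ℂ) hre him hneC hLρ'
  subst hρρ
  refine ⟨rfl, ?_, ?_⟩
  · refine hρ'K.trans (hK1.trans (hK2.trans ?_))
    rw [div_le_iff₀ hℓ0]
    have h1 : K / δ₀ ≤ ell D := by linarith
    have h2 : K ≤ ell D * δ₀ := (div_le_iff₀ hδ₀0).mp h1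
    linarith only [h2]
  · have hlog4pos : 0 < Real.log 4 := Real.log_pos (by norm_num)
    have h3 : K / ell D ^ 2 ≤ cL / (2 * ell D) := by
      rw [div_le_div_iff₀ (by positivity) (by positivity)]
      have h4 : 2 * K ≤ cL * ell D := by
        have h := mul_le_mul_of_nonneg_left (by linarith : 2 * K / cL ≤ ell D) hcL0.le
        rwa [mul_div_cancel₀ _ hcL0.ne'] at h
      nlinarith
    have h4 : cL / (2 * ell D) ≤ cL / (Real.log D + Real.log 4) := by
      rw [hlogD]; exact div_le_div_of_nonneg_left hcL0.le (by positivity) (by linarith)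
    linarith [hρ'K.trans hK1]

/-! ### The length `Y = P₄/d` -/

/-- For `d·l < P·t₀·T⁻³`, `l ≥ 1`: `0 < P₄`, `T ≤ P₄/d`, `1 ≤ P₄/d ≤ P·t₀`.
[cite: Zhang2022LandauSiegel, §15 p. 85; §6 p. 12] -/
private theorem length_package {D d l : ℕ} (hd : 1 ≤ d) (hl : 1 ≤ l) (hℓ1 : 1 ≤ ell D)
    (hdl : ((d * l : ℕ) : ℝ) < bigP D * t0 D / bigT D ^ 3) :
    0 < P4 D ∧ bigT D ≤ P4 D / d ∧ 1 ≤ P4 D / d ∧ 0 < P4 D / d ∧ P4 D / d ≤ bigP D * t0 D := by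
  have hT1 : 1 ≤ bigT D := Real.one_le_exp (Real.rpow_nonneg (Real.log_natCast_nonneg D) _)
  have hT0 : 0 < bigT D := by linarith
  have hP0 : 0 < bigP D := Real.exp_pos _
  have ht0 : 1 ≤ t0 D := by rw [t0]; exact one_le_pow₀ hℓ1
  have hP4 : 0 < P4 D := by rw [P4]; positivity
  have hd0 : (0 : ℝ) < d := by exact_mod_cast hd
  have hdl' : (d : ℝ) < bigP D * t0 D / bigT D ^ 3 := by
    have : (d : ℝ) ≤ ((d * l : ℕ) : ℝ) := by exact_mod_cast Nat.le_mul_of_pos_right d hl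
    linarith
  have hTY : bigT D ≤ P4 D / d := by
    rw [le_div_iff₀ hd0, P4]
    have h1 : (d : ℝ) * bigT D ^ 3 < bigP D * t0 D := by rwa [lt_div_iff₀ (by positivity)] at hdl'
    rw [div_mul_eq_mul_div, le_div_iff₀ (by positivity)]
    nlinarith
  have hY1 : 1 ≤ P4 D / d := hT1.trans hTY
  refine ⟨hP4, hTY, hY1, by linarith, ?_⟩
  calc P4 D / d ≤ P4 D := div_le_self hP4.le (by exact_mod_cast hd)
    _ = bigP D * t0 D / bigT D ^ 2 := by rw [P4]; ring
    _ ≤ bigP D * t0 D := div_le_self (by positivity) (one_le_pow₀ hT1)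

/-! ### The final combination (abstract) -/

/-- Triangle bookkeeping: `𝒟 − λS = (𝒟 − λI) + λ(I − (R_a+R_b+R_k+R_ρ)) + λR_ρ` when `R_a+R_b+R_k = S`.
[folklore] -/
private theorem final_bound {cD lam I Ra Rb Rk Rr S : ℂ} {eu eI eR L : ℝ}
    (hu : ‖cD - lam * I‖ ≤ eu) (hI : ‖I - (Ra + Rb + Rk + Rr)‖ ≤ eI) (hres : Ra + Rb + Rk = S)
    (hRr : ‖Rr‖ ≤ eR) (hlam : ‖lam‖ ≤ L) : ‖cD - lam * S‖ ≤ eu + L * (eI + eR) := by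
  have hdecomp : cD - lam * S = (cD - lam * I) + lam * ((I - (Ra + Rb + Rk + Rr)) + Rr) := by
    rw [← hres]; ring
  rw [hdecomp]
  have hL0 : 0 ≤ L := (norm_nonneg _).trans hlam
  calc ‖(cD - lam * I) + lam * ((I - (Ra + Rb + Rk + Rr)) + Rr)‖
      ≤ ‖cD - lam * I‖ + ‖lam * ((I - (Ra + Rb + Rk + Rr)) + Rr)‖ := norm_add_le _ _
    _ ≤ eu + L * (eI + eR) := by
        refine add_le_add hu ?_
        rw [norm_mul]
        exact mul_le_mul hlam ((norm_add_le _ _).trans (add_le_add hI hRr)) (norm_nonneg _) hL0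

/-! ### The theorem -/

/-- **(15.15), RANGED + WEIGHTED (statement of record; zl-w15-p1 INTERFACE-1515, exponent 1994 per the
residue side p483821).** There are absolute `c > 0`, `c₀`, `C` such that for all large `D`, under (A), for
all `d, l ≥ 1` with `dl < P·t₀·T⁻³`:
`‖𝒟₁(d,l) − λ₁(d)Σ_{j≤3}ℛ_{1j}d^{β_j}ℳ₁(d,l;1−β_j)‖ ≤ C·(e^{−c𝓛^{1/10}} + 𝓛⁻¹⁹⁹⁴)·∏_{q∣dl}(1 + c₀q^{−9/10})`.
[cite: Zhang2022LandauSiegel, §15 (15.15)–(15.16) p. 85] -/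
theorem eq15_15_ranged (c' : ℝ) :
    ∃ c : ℝ, 0 < c ∧ ∃ c₀ C : ℝ, ForAllLarge fun D _ χ => AssumptionA D χ →
      ∀ d l : ℕ, 1 ≤ d → 1 ≤ l → ((d * l : ℕ) : ℝ) < bigP D * t0 D / bigT D ^ 3 →
        ‖calD1 c' χ d l -
            lam1 c' χ d 1 * ∑ j ∈ ({1, 2, 3} : Finset ℕ),
              calR1 c' χ j * (d : ℂ) ^ betaJ c' D j * calM1 c' χ d l (1 - betaJ c' D j)‖ ≤
          C * (Real.exp (-c * ell D ^ (1 / 10 : ℝ)) + (ell D ^ 1994)⁻¹) *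
            ∏ q ∈ (d * l).primeFactors, (1 + c₀ * (q : ℝ) ^ (-(9 / 10 : ℝ))) := by
  classical
  -- ### the landed inputs
  obtain ⟨cu, hcu0, Cu, hu⟩ :=
    step15_u036_of_eq15_14 c' (eq15_14_holds c') (step15_u034_of c' (step15_u030_holds c'))
  obtain ⟨c₁, hc₁0, hc₁12, c₀, hc₀0, CA, hCA0, hA⟩ := phi1515_bounds c'
  have h34 := step15_u034an_holds c'
  have hcΦ := continuous_phi1515_line c'
  obtain ⟨cL, hcL0, hcL4, CL, hCL0, K, hK0, D₁, hpk⟩ := Lemma84.exceptional_package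
  obtain ⟨Cρ, δ₀, hCρ0, hδ₀0, hδ₀4, hRρ⟩ := norm_resRho_1515_le
  have hc₁1 : c₁ ≤ 1 := by linarith
  obtain ⟨D₂, hrem⟩ := GaussKernelContour.remainder_le_eps1 hc₁0 hc₁1 13
  obtain ⟨c₃₅, C₃₅, h35⟩ := step15_u035_holds c'
  -- ### constants
  obtain ⟨cw, hcw⟩ : ∃ cw : ℝ, cw = c₀ + |c₃₅| + c₀ * |c₃₅| := ⟨_, rfl⟩
  have hcw0 : 0 ≤ cw := by rw [hcw]; positivity
  obtain ⟨Cr, hCr⟩ : ∃ Cr : ℝ, Cr = Cρ * (CL + 1) * 2 * (8 / Real.pi ^ 3) * K * |C₃₅| := ⟨_, rfl⟩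
  have hCr0 : 0 ≤ Cr := by rw [hCr]; positivity
  refine ⟨min cu (c₁ / 2), lt_min hcu0 (by linarith), 8 + cw + 8 * cw, |Cu| + (CA + Cr), ?_⟩
  -- ### thresholds in `D`
  obtain ⟨D₃, hD₃⟩ := exists_nat_le_ell' (max (max (max 3 (240 * |c'| + 1)) (max (K / δ₀ + 1)
    (2 * K / cL + 2))) (max (4 * (Nat.factorial 21 : ℝ)) (K / c₁ + 1)))
  have hLarge : ForAllLarge fun D _ _ => D₁ ≤ D ∧ D₂ ≤ D ∧ D₃ ≤ D :=
    ForAllLarge.of_le (max (max D₁ D₂) D₃) fun D _ _ hD _ _ =>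
      ⟨(le_max_left _ _).trans ((le_max_left _ _).trans hD),
        (le_max_right _ _).trans ((le_max_left _ _).trans hD), (le_max_right _ _).trans hD⟩
  refine ((((hu.and hA).and (h34.and hcΦ)).and h35).and hLarge).mono ?_
  intro D _ χ hq hp ⟨⟨⟨⟨eu, eA⟩, e34, ecΦ⟩, e35⟩, hD₁, hD₂, hD₃'⟩ hAA d l hd hl hdl
  -- ### the parameters at this `D`
  have hℓall := hD₃ D hD₃'
  simp only [max_le_iff] at hℓall
  obtain ⟨⟨⟨hℓ3, hℓc'⟩, hℓKδ, hℓKc⟩, hℓfac, hℓKc₁⟩ := hℓall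
  have hℓ1 : 1 ≤ ell D := by linarith only [hℓ3]
  have hℓ0 : 0 < ell D := by linarith only [hℓ3]
  have hDpos : 0 < D := Nat.pos_of_ne_zero (NeZero.ne D)
  have hD0 : (0 : ℝ) < D := by exact_mod_cast hDpos
  have hD3 : 3 ≤ D := by
    by_contra h
    have hD2 : (D : ℝ) ≤ 2 := by exact_mod_cast (by omega : D ≤ 2)
    have h2 : ell D ≤ Real.log 2 := Real.log_le_log hD0 hD2
    have h3 : Real.log 2 < 1 := by linarith only [Real.log_two_lt_d9]
    linarith only [hℓ3, h2, h3]
  have hχ1 : χ ≠ 1 := ne_one_of_isPrimitive_of_three_le hp hD3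
  have hexpℓ : Real.exp (ell D) = D := by rw [ell, Real.exp_log hD0]
  have hlog4 : Real.log 4 ≤ ell D := by
    have := Real.log_le_sub_one_of_pos (show (0:ℝ) < 4 by norm_num); linarith only [this, hℓ3]
  -- ### the shifts
  obtain ⟨hα0, hα14, hβ1re, hβ2re, hβ3re, hβ1im, hβ2im, hβ3im, hb1lo, hb12, hb23, hb3hi,
    hn1, hn2, hn3⟩ := shifts_package c' (D := D) hℓ3 hℓc'
  have hα1 : alpha D ≤ 1 := by linarith only [hα14]
  have hb1pos : 0 < b1 c' D := by linarith only [hα0, hb1lo]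
  have hb2pos : 0 < b2 c' D := by linarith only [hb1pos, hb12]
  have hb3pos : 0 < b3 c' D := by linarith only [hb2pos, hb23]
  have hne : ∀ {β : ℂ} {b : ℝ}, β.im = b → 0 < b → β ≠ 0 := by
    intro β b h hb h0; rw [h0, Complex.zero_im] at h; exact (ne_of_gt hb) h.symm
  have h10 : beta1 c' D ≠ 0 := hne hβ1im hb1pos
  have h20 : beta2 c' D ≠ 0 := hne hβ2im hb2pos
  have h30 : beta3 c' D ≠ 0 := hne hβ3im hb3pos
  have hne' : ∀ {β γ : ℂ} {b g : ℝ}, β.im = b → γ.im = g → b < g → β ≠ γ := by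
    intro β γ b g h1 h2 hlt heq
    have : b = g := by rw [← h1, ← h2, heq]
    exact (ne_of_lt hlt) this
  have h12 : beta1 c' D ≠ beta2 c' D := hne' hβ1im hβ2im hb12
  have h13 : beta1 c' D ≠ beta3 c' D := hne' hβ1im hβ3im (hb12.trans hb23)
  have h23 : beta2 c' D ≠ beta3 c' D := hne' hβ2im hβ3im hb23
  have hζ1' : riemannZeta (1 - beta1 c' D) ≠ 0 := riemannZeta_ne_zero_of_one_le_re (by simp [hβ1re])
  have hζ2' : riemannZeta (1 - beta2 c' D) ≠ 0 := riemannZeta_ne_zero_of_one_le_re (by simp [hβ2re])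
  have hζ3' : riemannZeta (1 - beta3 c' D) ≠ 0 := riemannZeta_ne_zero_of_one_le_re (by simp [hβ3re])
  have hL1' : χ.LFunction (1 - beta1 c' D) ≠ 0 :=
    DirichletCharacter.LFunction_ne_zero_of_one_le_re χ (Or.inl hχ1) (by simp [hβ1re])
  have hL2' : χ.LFunction (1 - beta2 c' D) ≠ 0 :=
    DirichletCharacter.LFunction_ne_zero_of_one_le_re χ (Or.inl hχ1) (by simp [hβ2re])
  have hL3' : χ.LFunction (1 - beta3 c' D) ≠ 0 :=
    DirichletCharacter.LFunction_ne_zero_of_one_le_re χ (Or.inl hχ1) (by simp [hβ3re])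
  -- ### the length `Y = P₄/d`
  obtain ⟨hP4, hTY, hY1, hY0, hYP⟩ := length_package (D := D) hd hl hℓ1 hdl
  -- ### Part A at this `D`, and the exceptional zero
  obtain ⟨⟨ρ, hρ1, hρc₁, hLρ, hL'ρ, hLreg⟩, hζreg, hΦall⟩ := eA hAA
  obtain ⟨hline, hleft, hhoriz⟩ := hΦall d l hd hl
  have hAA' : ‖χ.LFunction 1‖ < (Real.log D ^ 2022)⁻¹ := by
    rw [inv_eq_one_div]; exact hAA
  obtain ⟨ρ', hρ'1, hρ'K, hLρ', hL'ρ', hpk'⟩ := hpk D χ hD₁ hχ1 hAA'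
  obtain ⟨hρρ, h1ρδ, h1ρcL⟩ := rho_package χ hc₁0 hK0 hδ₀0 hcL0 hℓ1 hℓKc₁ hℓKδ hℓKc hlog4
    hLρ' hρ'K (fun w hw hwi hwρ => (hLreg w hw hwi hwρ).1)
  subst hρρ
  -- ### the open box for `core` (height `H = 𝓛²⁰`, depth `η = c₁/𝓛`)
  obtain ⟨η, hη⟩ : ∃ η : ℝ, η = c₁ / ell D := ⟨_, rfl⟩
  obtain ⟨H, hHdef⟩ : ∃ H : ℝ, H = ell D ^ 20 := ⟨_, rfl⟩
  have hηpos : 0 < η := by rw [hη]; positivity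
  have hη10 : η < 1 / 10 := by
    rw [hη, div_lt_iff₀ hℓ0]; linarith only [hc₁12, hℓ3]
  have hHD : H < (D : ℝ) / 2 := by
    have h := two_mul_pow_twenty_le_exp hℓfac
    rw [hexpℓ] at h; rw [hHdef]; linarith only [h]
  have hH1 : (1 : ℝ) ≤ H := by rw [hHdef]; exact one_le_pow₀ hℓ1
  have hHpos : (0 : ℝ) < H := by linarith only [hH1]
  have hH4 : (4 : ℝ) ≤ H := by
    have h1 : (3 : ℝ) ^ 20 ≤ ell D ^ 20 := pow_le_pow_left₀ (by norm_num) hℓ3 20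
    have h2 : (4 : ℝ) ≤ (3 : ℝ) ^ 20 := by norm_num
    rw [hHdef]; exact h2.trans h1
  have hρc₁' : 1 - ρ' < η := by
    have h1 : c₁ / (2 * ell D) = (c₁ / ell D) / 2 := by ring
    have h2 : 0 < c₁ / ell D := by positivity
    rw [hη]; linarith only [hρc₁, h1, h2]
  obtain ⟨a₁, H₁, ha₁, ha₁a, hHH₁, hUζ, hUL⟩ :=
    open_box_of_closed_region χ hχ1 (η := η) (H := H) (R := (D : ℝ) / 2)
      (ρ := ρ') hη10 hH1 hHD hρ'1 hρc₁'
      (fun w hw hwi hwρ => (hLreg w (by rw [← hη]; exact hw) hwi hwρ).1)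
      (fun w hw hw2 hwi hw1 => (hζreg w (by rw [← hη]; exact hw) hw2 hwi hw1).1)
  -- ### the regularised `Φ`, its three bounds, continuity, integrability
  obtain ⟨Φ, hΦ⟩ : ∃ Φ : ℂ → ℂ, ∀ s, Φ s = riemannZeta (1 + s + beta1 c' D) *
      riemannZeta (1 + s + beta2 c' D) * calM1 c' χ d l (1 + s) * (d : ℂ) ^ beta3 c' D * s /
      (riemannZeta₁ (1 + s) * χ.LFunction (1 + s)) := ⟨fun s => _, fun s => rfl⟩
  obtain ⟨W, hWdef⟩ : ∃ W : ℝ, W = ∏ q ∈ (d * l).primeFactors, (1 + c₀ * (q : ℝ) ^ (-(9 / 10 : ℝ))) :=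
    ⟨_, rfl⟩
  have hW1 : 1 ≤ W := by
    rw [hWdef]
    exact Finset.one_le_prod fun q _ => by
      have : 0 ≤ c₀ * (q : ℝ) ^ (-(9 / 10 : ℝ)) :=
        mul_nonneg hc₀0 (Real.rpow_nonneg (Nat.cast_nonneg q) _)
      linarith only [this]
  have hW0 : 0 ≤ W := by linarith only [hW1]
  have hΦeq : ∀ {s : ℂ}, s ≠ 0 → Φ s = riemannZeta (1 + s + beta1 c' D) *
      riemannZeta (1 + s + beta2 c' D) * calM1 c' χ d l (1 + s) /
      (riemannZeta (1 + s) * χ.LFunction (1 + s)) * (d : ℂ) ^ beta3 c' D := fun hs =>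
    Phi_eq_of_ne_zero χ Φ (calM1 c' χ d l) ((d : ℂ) ^ beta3 c' D) (beta1 c' D) (beta2 c' D) hΦ hs
  -- real and imaginary parts of the contour points
  have re1 : ∀ t : ℝ, ((((1 : ℝ) : ℂ) + t * I)).re = 1 := fun t => by simp
  have reL : ∀ t : ℝ, ((((-η : ℝ) : ℂ) + t * I)).re = -η := fun t => by simp
  have imL : ∀ t : ℝ, ((((-η : ℝ) : ℂ) + t * I)).im = t := fun t => by simp
  have reH : ∀ u v : ℝ, (((u : ℂ) + ((v : ℝ) : ℂ) * I)).re = u := fun u v => by simp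
  have imH : ∀ u v : ℝ, (((u : ℂ) + ((v : ℝ) : ℂ) * I)).im = v := fun u v => by simp
  have ne_of_re : ∀ {s : ℂ} {x : ℝ}, s.re = x → x ≠ 0 → s ≠ 0 := by
    intro s x h hx h0; rw [h0, Complex.zero_re] at h; exact hx h.symm
  have ne_of_im : ∀ {s : ℂ} {x : ℝ}, s.im = x → x ≠ 0 → s ≠ 0 := by
    intro s x h hx h0; rw [h0, Complex.zero_im] at h; exact hx h.symm
  have hΦline : ∀ t : ℝ, ‖Φ (((1 : ℝ) : ℂ) + t * I)‖ ≤ CA * W := by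
    intro t
    rw [hΦeq (ne_of_re (re1 t) one_ne_zero), hWdef]
    exact (hline _ (re1 t)).2.2
  have hΦ₀ : ∀ t : ℝ, H ≤ |t| → ‖Φ (((1 : ℝ) : ℂ) + t * I)‖ ≤ CA * W := fun t _ => hΦline t
  have hΦ₁ : ∀ t : ℝ, |t| ≤ H → ‖Φ (((-η : ℝ) : ℂ) + t * I)‖ ≤ CA * ell D ^ 13 * W := by
    intro t ht
    rw [hΦeq (ne_of_re (reL t) (by linarith only [hηpos])), hWdef]
    exact (hleft _ (by rw [reL, hη]) (by rw [imL]; exact ht.trans hHD.le)).2.2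
  have hΦ₂ : ∀ u : ℝ, -η ≤ u → u ≤ 1 →
      ‖Φ ((u : ℂ) + ((H : ℝ) : ℂ) * I)‖ ≤ CA * ell D ^ 13 * W ∧
        ‖Φ ((u : ℂ) + ((-H : ℝ) : ℂ) * I)‖ ≤ CA * ell D ^ 13 * W := by
    intro u hu1 hu2
    have habsH : |H| = H := abs_of_pos hHpos
    have habsH' : |(-H)| = H := by rw [abs_neg, habsH]
    constructor
    · rw [hΦeq (ne_of_im (imH u H) hHpos.ne'), hWdef]
      exact (hhoriz _ (by rw [reH, ← hη]; exact hu1) (by rw [reH]; exact hu2)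
        (by rw [imH, habsH]; exact hH4) (by rw [imH, habsH]; exact hHD.le)).2.2
    · rw [hΦeq (ne_of_im (imH u (-H)) (by linarith only [hHpos])), hWdef]
      exact (hhoriz _ (by rw [reH, ← hη]; exact hu1) (by rw [reH]; exact hu2)
        (by rw [imH, habsH']; exact hH4) (by rw [imH, habsH']; exact hHD.le)).2.2
  have hcont : Continuous fun t : ℝ => Φ (((1 : ℝ) : ℂ) + t * I) := by
    refine (ecΦ hAA d l hd hl).congr fun t => ?_
    exact (hΦeq (ne_of_re (re1 t) one_ne_zero)).symm
  have hΛ : (0 : ℝ) < ell D ^ 30 := by positivity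
  have hint := GaussKernelContour.integrable_integrand_line (Φ := Φ) (β := beta3 c' D)
    (Λ := ell D ^ 30) (Y := P4 D / d) hΛ hY0 (σ := 1) (M := CA * W)
    (by rw [hβ3re]; norm_num) hcont hΦline
  -- ### the contour core
  have hMd : DifferentiableOn ℂ (calM1 c' χ d l) {w : ℂ | 9 / 10 < w.re} := (e34 hAA d l hd hl).2
  have hb31 : b3 c' D ≤ 1 := by linarith only [hb3hi, hα14]
  have hβH : |(beta3 c' D).im| < H := by
    rw [hβ3im, abs_of_pos hb3pos]; linarith only [hb31, hH4]
  have hβaH : |(beta1 c' D).im| < H := by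
    rw [hβ1im, abs_of_pos hb1pos]; linarith only [hb12, hb23, hb31, hH4]
  have hβbH : |(beta2 c' D).im| < H := by
    rw [hβ2im, abs_of_pos hb2pos]; linarith only [hb23, hb31, hH4]
  have ha0 : -η < 0 := by linarith only [hηpos]
  have haρ : -η < ρ' - 1 := by linarith only [hρc₁']
  have hcore := core χ Φ (calM1 c' χ d l) ((d : ℂ) ^ beta3 c' D) (beta1 c' D) (beta2 c' D)
    (beta3 c' D) (P4 D / d) (ell D ^ 30) hχ1 hMd hY0 hΛ hΦ hβ1re hβ2re hβ3re h10 h20 h30 h12 h13 h23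
    ha₁ ha₁a ha0 hHH₁ hβH hβaH hβbH hLρ' hL'ρ' hρ'1 haρ hUζ hUL
    (by positivity : (0:ℝ) ≤ CA * W) (by positivity : (0:ℝ) ≤ CA * ell D ^ 13 * W)
    (by positivity : (0:ℝ) ≤ CA * ell D ^ 13 * W) hΦ₀ hΦ₁ hΦ₂ hint
  -- ### the remainder at Zhang's scales
  have hβim1 : |(beta3 c' D).im| ≤ 1 := by rw [hβ3im, abs_of_pos hb3pos]; exact hb31
  have hℓ13 : (1 : ℝ) ≤ ell D ^ 13 := one_le_pow₀ hℓ1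
  have hM₀ : CA * W ≤ CA * W * ell D ^ 13 := le_mul_of_one_le_right (by positivity) hℓ13
  have hM₁ : CA * ell D ^ 13 * W ≤ CA * W * ell D ^ 13 * (1 : ℝ) ^ (c₁ / ell D) := by
    rw [Real.one_rpow, mul_one]; linarith only [show CA * ell D ^ 13 * W = CA * W * ell D ^ 13 by ring]
  have hM₂ : CA * ell D ^ 13 * W ≤ CA * W * ell D ^ 13 * (P4 D / d) ^ (c₁ / ell D) := by
    have h1 : (1 : ℝ) ≤ (P4 D / d) ^ (c₁ / ell D) := Real.one_le_rpow hY1 (by positivity)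
    calc CA * ell D ^ 13 * W = CA * W * ell D ^ 13 * 1 := by ring
      _ ≤ CA * W * ell D ^ 13 * (P4 D / d) ^ (c₁ / ell D) :=
          mul_le_mul_of_nonneg_left h1 (by positivity)
  have hR := hrem hD₂ (by positivity : (0 : ℝ) ≤ CA * W) hβ3re hβim1 hY1 hYP one_pos
    (by rw [one_mul]; exact hTY) hHdef.symm.le rfl rfl (by rw [hη] : -η = -(c₁ / ell D)) hM₀ hM₁ hM₂
  have hIres := hcore.trans hR
  -- ### the residues
  have hres := res_sum_eq_sum_calR1 c' χ hχ1 hP4 hd l hΦ h10 h20 h30 h12 h13 h23 hζ1' hζ2' hζ3'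
    hL1' hL2' hL3'
  -- the `ρ̃ − 1` residue
  obtain ⟨W₃, hW₃def⟩ : ∃ W₃ : ℝ, W₃ = ∏ q ∈ (d * l).primeFactors, (1 + |c₃₅| * (q : ℝ) ^ (-(9 / 10 : ℝ))) :=
    ⟨_, rfl⟩
  have hW₃0 : 0 ≤ W₃ := by
    rw [hW₃def]; exact Finset.prod_nonneg fun q _ => by
      have : 0 ≤ |c₃₅| * (q : ℝ) ^ (-(9 / 10 : ℝ)) :=
        mul_nonneg (abs_nonneg _) (Real.rpow_nonneg (Nat.cast_nonneg q) _)
      linarith only [this]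
  have hρ'34 : 9 / 10 < ((ρ' : ℂ)).re := by
    have h1 : c₁ / (2 * ell D) ≤ 1 / 72 := by
      rw [div_le_div_iff₀ (by positivity) (by norm_num)]; nlinarith only [hc₁12, hℓ3, hc₁0]
    simp only [Complex.ofReal_re]; linarith only [hρc₁, h1]
  have hMM : ‖calM1 c' χ d l ρ'‖ ≤ |C₃₅| * W₃ := by
    have h1 := e35 hAA d l hd hl (ρ' : ℂ) hρ'34
    refine h1.trans ?_
    calc C₃₅ * ∏ q ∈ (d * l).primeFactors, (1 + c₃₅ * (q : ℝ) ^ (-(9 / 10 : ℝ)))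
        ≤ |C₃₅ * ∏ q ∈ (d * l).primeFactors, (1 + c₃₅ * (q : ℝ) ^ (-(9 / 10 : ℝ)))| := le_abs_self _
      _ = |C₃₅| * |∏ q ∈ (d * l).primeFactors, (1 + c₃₅ * (q : ℝ) ^ (-(9 / 10 : ℝ)))| := abs_mul _ _
      _ ≤ |C₃₅| * W₃ := by
          rw [hW₃def]; exact mul_le_mul_of_nonneg_left (abs_weight_le c₃₅) (abs_nonneg _)
  have hb1' : alpha D / 2 ≤ ‖beta1 c' D‖ := by rw [hn1]; exact hb1lo
  have hb2' : alpha D / 2 ≤ ‖beta2 c' D‖ := by rw [hn2]; linarith only [hb1lo, hb12]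
  have hb3' : alpha D / 2 ≤ ‖beta3 c' D‖ := by rw [hn3]; linarith only [hb1lo, hb12, hb23]
  have hb1'' : ‖beta1 c' D‖ ≤ 1 := by rw [hn1]; linarith only [hb12, hb23, hb31]
  have hb2'' : ‖beta2 c' D‖ ≤ 1 := by rw [hn2]; linarith only [hb23, hb31]
  have hb3'' : ‖beta3 c' D‖ ≤ 1 := by rw [hn3]; exact hb31
  have hRr := hRρ c' D inferInstance χ d l ρ' (|C₃₅| * W₃) cL CL hχ1 hd hY1 hℓ1 hα0 hα1 hb1' hb2' hb3'
    hb1'' hb2'' hb3'' hρ'1 h1ρδ h1ρcL hLρ' hL'ρ' hCL0 hpk' hMM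
  -- its size: `≪ 𝓛⁻¹⁹⁹⁴·W₃`
  have hRrB : Cρ * (CL + 1) * (Real.log D + Real.log 4) * (alpha D)⁻¹ ^ 3 * (1 - ρ') *
      (|C₃₅| * W₃) ≤ Cr / 8 * (ell D ^ 1994)⁻¹ * W₃ := by
    have hlogD : Real.log (D : ℝ) = ell D := rfl
    have hα : alpha D = Real.pi / ell D ^ 9 := by rw [alpha, log_bigP]
    have hαinv : (alpha D)⁻¹ ^ 3 = ell D ^ 27 / Real.pi ^ 3 := by
      rw [hα, inv_div]; ring
    have hlog4 : Real.log 4 ≤ 3 := by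
      have := Real.log_le_sub_one_of_pos (show (0:ℝ) < 4 by norm_num); linarith only [this]
    have h1 : Real.log D + Real.log 4 ≤ 2 * ell D := by rw [hlogD]; linarith only [hlog4, hℓ3]
    have h2 : 1 - ρ' ≤ K / ell D ^ 2022 := by rw [div_eq_mul_inv, ← hlogD]; exact hρ'K
    have h1ρ0 : 0 ≤ 1 - ρ' := by linarith only [hρ'1]
    have hlogpos : 0 ≤ Real.log D + Real.log 4 := by
      rw [hlogD]; linarith only [hℓ0, Real.log_pos (show (1:ℝ) < 4 by norm_num)]
    calc Cρ * (CL + 1) * (Real.log D + Real.log 4) * (alpha D)⁻¹ ^ 3 * (1 - ρ') * (|C₃₅| * W₃)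
        = (Cρ * (CL + 1) * |C₃₅| * W₃) * ((Real.log D + Real.log 4) * ((alpha D)⁻¹ ^ 3 * (1 - ρ'))) := by
          ring
      _ ≤ (Cρ * (CL + 1) * |C₃₅| * W₃) * ((2 * ell D) * (ell D ^ 27 / Real.pi ^ 3 * (K / ell D ^ 2022))) := by
          apply mul_le_mul_of_nonneg_left _ (by positivity)
          rw [hαinv]
          exact mul_le_mul h1 (mul_le_mul_of_nonneg_left h2 (by positivity)) (by positivity)
            (by positivity)
      _ = Cr / 8 * (ell D ^ 1994)⁻¹ * W₃ := by
          rw [hCr]; field_simp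
  -- ### §15.u036 and the integrand on the line
  have hu036 := eu hAA d l hd hl
  have hIeq : (∫ t : ℝ, integrandU036 c' χ d l (1 + t * I)) =
      ∫ t : ℝ, Φ (((1 : ℝ) : ℂ) + t * I) * ((((P4 D / d : ℝ) : ℂ)) ^ ((((1 : ℝ) : ℂ) + t * I) + beta3 c' D) *
        omega1 (ell D ^ 30) ((((1 : ℝ) : ℂ) + t * I) + beta3 c' D) /
          ((((1 : ℝ) : ℂ) + t * I) + beta3 c' D)) := by
    congr 1; funext t; exact integrandU036_line_eq c' χ hd hP4 l hΦ t
  rw [hIeq] at hu036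
  -- ### weights
  obtain ⟨W₈, hW₈def⟩ : ∃ W₈ : ℝ, W₈ = ∏ q ∈ (d * l).primeFactors, (1 + 8 * (q : ℝ) ^ (-(9 / 10 : ℝ))) :=
    ⟨_, rfl⟩
  have hlam : ‖lam1 c' χ d 1‖ ≤ W₈ := by
    rw [hW₈def]
    exact (norm_lam1_one_le_prod c' χ d).trans
      (prod_one_add_div_le_weight (by omega) (by omega))
  have hW₈0 : 0 ≤ W₈ := (norm_nonneg _).trans hlam
  obtain ⟨W', hW'def⟩ : ∃ W' : ℝ, W' = ∏ q ∈ (d * l).primeFactors,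
      (1 + (8 + cw + 8 * cw) * (q : ℝ) ^ (-(9 / 10 : ℝ))) := ⟨_, rfl⟩
  have hc₀cw : c₀ ≤ cw := by rw [hcw]; nlinarith only [hc₀0, abs_nonneg c₃₅]
  have hc₃₅cw : |c₃₅| ≤ cw := by rw [hcw]; nlinarith only [hc₀0, abs_nonneg c₃₅]
  have hWW' : W₈ * W ≤ W' := by
    rw [hW₈def, hWdef, hW'def]
    exact (mul_le_mul_of_nonneg_left (weight_mono hc₀0 hc₀cw)
      (by rw [← hW₈def]; exact hW₈0)).trans (weight_mul_weight_le (by norm_num) hcw0)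
  have hW₃W' : W₈ * W₃ ≤ W' := by
    rw [hW₈def, hW₃def, hW'def]
    exact (mul_le_mul_of_nonneg_left (weight_mono (abs_nonneg _) hc₃₅cw)
      (by rw [← hW₈def]; exact hW₈0)).trans (weight_mul_weight_le (by norm_num) hcw0)
  have hW'1 : 1 ≤ W' := by
    rw [hW'def]
    exact Finset.one_le_prod fun q _ => by
      have : 0 ≤ (8 + cw + 8 * cw) * (q : ℝ) ^ (-(9 / 10 : ℝ)) :=
        mul_nonneg (by positivity) (Real.rpow_nonneg (Nat.cast_nonneg q) _)
      linarith only [this]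
  -- ### the two small quantities
  obtain ⟨ε, hεdef⟩ : ∃ ε : ℝ, ε = Real.exp (-(min cu (c₁ / 2)) * ell D ^ (1 / 10 : ℝ)) := ⟨_, rfl⟩
  have hε0 : 0 ≤ ε := by rw [hεdef]; exact (Real.exp_pos _).le
  have hℓtenth : ell D ^ (1 / 10 : ℝ) ≤ ell D ^ 10 := by
    calc ell D ^ (1 / 10 : ℝ) ≤ ell D ^ (1 : ℝ) :=
          Real.rpow_le_rpow_of_exponent_le hℓ1 (by norm_num)
      _ = ell D ^ (1 : ℕ) := by rw [← Real.rpow_natCast]; norm_num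
      _ ≤ ell D ^ 10 := pow_le_pow_right₀ hℓ1 (by norm_num)
  have hℓtenth0 : 0 ≤ ell D ^ (1 / 10 : ℝ) := Real.rpow_nonneg hℓ0.le _
  have hεu : Real.exp (-cu * ell D ^ 10) ≤ ε := by
    rw [hεdef]; apply Real.exp_le_exp.mpr
    have h1 : min cu (c₁ / 2) ≤ cu := min_le_left _ _
    have h2 : min cu (c₁ / 2) * ell D ^ (1 / 10 : ℝ) ≤ cu * ell D ^ 10 :=
      mul_le_mul h1 hℓtenth hℓtenth0 hcu0.le
    linarith only [h2]
  have hε₁ : Real.exp (-(c₁ / 2) * ell D ^ (1 / 10 : ℝ)) ≤ ε := by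
    rw [hεdef]; apply Real.exp_le_exp.mpr
    have h1 : min cu (c₁ / 2) ≤ c₁ / 2 := min_le_right _ _
    have h2 := mul_le_mul_of_nonneg_right h1 hℓtenth0
    linarith only [h2]
  obtain ⟨pℓ, hpℓdef⟩ : ∃ pℓ : ℝ, pℓ = (ell D ^ 1994)⁻¹ := ⟨_, rfl⟩
  have hpℓ0 : 0 ≤ pℓ := by rw [hpℓdef]; positivity
  -- ### conclusion
  have key := final_bound hu036 hIres hres hRr hlam
  refine key.trans ?_
  rw [← hW'def, ← hεdef, ← hpℓdef]
  rw [← hpℓdef] at hRrB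
  have t1 : Cu * Real.exp (-cu * ell D ^ 10) ≤ |Cu| * ε * W' :=
    calc Cu * Real.exp (-cu * ell D ^ 10) ≤ |Cu| * ε :=
          mul_le_mul (le_abs_self Cu) hεu (Real.exp_pos _).le (abs_nonneg _)
      _ ≤ |Cu| * ε * W' := le_mul_of_one_le_right (by positivity) hW'1
  have t2 : W₈ * (CA * W * Real.exp (-(c₁ / 2) * ell D ^ (1 / 10 : ℝ))) ≤ CA * ε * W' :=
    calc W₈ * (CA * W * Real.exp (-(c₁ / 2) * ell D ^ (1 / 10 : ℝ)))
        = CA * Real.exp (-(c₁ / 2) * ell D ^ (1 / 10 : ℝ)) * (W₈ * W) := by ring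
      _ ≤ CA * ε * W' :=
          mul_le_mul (mul_le_mul_of_nonneg_left hε₁ hCA0) hWW' (by positivity) (by positivity)
  have t3 : W₈ * (Cρ * (CL + 1) * (Real.log D + Real.log 4) * (alpha D)⁻¹ ^ 3 * (1 - ρ') *
      (|C₃₅| * W₃)) ≤ Cr * pℓ * W' :=
    calc W₈ * (Cρ * (CL + 1) * (Real.log D + Real.log 4) * (alpha D)⁻¹ ^ 3 * (1 - ρ') *
        (|C₃₅| * W₃)) ≤ W₈ * (Cr / 8 * pℓ * W₃) := mul_le_mul_of_nonneg_left hRrB hW₈0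
      _ = Cr / 8 * pℓ * (W₈ * W₃) := by ring
      _ ≤ Cr / 8 * pℓ * W' := mul_le_mul_of_nonneg_left hW₃W' (by positivity)
      _ ≤ Cr * pℓ * W' := by
          have : 0 ≤ Cr * pℓ * W' := by positivity
          linarith only [this]
  have t4 : 0 ≤ |Cu| * pℓ * W' := by positivity
  have t5 : 0 ≤ CA * pℓ * W' := by positivity
  have t6 : 0 ≤ Cr * ε * W' := by positivity
  have hexp : (|Cu| + (CA + Cr)) * (ε + pℓ) * W' =
      |Cu| * ε * W' + |Cu| * pℓ * W' + CA * ε * W' + CA * pℓ * W' + Cr * ε * W' + Cr * pℓ * W' := by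
    ring
  rw [hexp, mul_add W₈]
  linarith only [t1, t2, t3, t4, t5, t6]

end Literature.NumberTheory.LFunctions.Zhang2022.Eq1515

end
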